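import Mathlib.Analysis.InnerProductSpace.PiL2
import Literature.Geometry.Lorentzian.Basic

/-!
# Route EIHFluxBalance — crux `InertialRecession` (E′), line `SketchCleanExcision`:
# the staircase, part 1 — geometric gap scales and single-linkage classes at one time

Helper file for the crux `stmt-FinalStateConjecture-17403`
(`Summit.FinalStateConjecture.FinalStateConjecture.Theses.EIHFluxBalance.InertialRecession`), registered stub
`stub_integratedClusterBalance` (skeleton r12, `Cruxes/InertialRecession/Lines/SketchCleanExcision.lean`).

The integrated cluster balance is proved by a STAIRCASE of static window covers of a member set `S`. A cover is
built at one time from a GAP SCALE: a length `σ` such that no pairwise distance of the configuration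
`ξ · s : Fin N → E3` restricted to `S` lies in the band `[σ, 16σ)` (the GAP PROPERTY). Then "distance `< σ`" is an
equivalence relation on `S` (`rep_eq_iff`): its classes are cliques of diameter `< σ`, mutually `≥ 16σ` apart,
and each class is represented by its least member (local notations `cls⟦…⟧`, `rep⟦…⟧`, `reps⟦…⟧`; no global
definitions). `exists_gap` finds such a scale in
`[L/16^(N²+1), L/16]` below any ceiling `L > 0` by pigeonhole over the `N² + 1` geometric bands
`[L/16^(j+1), L/16^j)` (a finite set of reals misses one of `card + 1` disjoint bands, `exists_gapScale`).
Mathlib only. [folklore]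
-/

noncomputable section

set_option linter.dupNamespace false

open scoped BigOperators Classical
open Finset

namespace Summit.FinalStateConjecture.FinalStateConjecture.Theorems.SublinearIsFree.Staircase

open Literature.Geometry.Lorentzian


/-! ### Geometric bands and the gap scale -/

/-- The geometric bands `[L/16^(j+1), L/16^j)` below a ceiling `L > 0` are pairwise disjoint. [folklore] -/
theorem band_eq_of_mem {L : ℝ} (hL : 0 < L) {j j' : ℕ} {d : ℝ} (hj : d ∈ Set.Ico (L / 16 ^ (j + 1)) (L / 16 ^ j))
    (hj' : d ∈ Set.Ico (L / 16 ^ (j' + 1)) (L / 16 ^ j')) : j = j' := by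
  by_contra hne
  simp only [Set.mem_Ico] at hj hj'
  rcases lt_or_gt_of_ne hne with h | h
  · have h1 : L / 16 ^ j' ≤ L / 16 ^ (j + 1) :=
      div_le_div_of_nonneg_left hL.le (by positivity) (pow_le_pow_right₀ (by norm_num) (by omega))
    linarith [hj.1, hj'.2]
  · have h1 : L / 16 ^ j ≤ L / 16 ^ (j' + 1) :=
      div_le_div_of_nonneg_left hL.le (by positivity) (pow_le_pow_right₀ (by norm_num) (by omega))
    linarith [hj'.1, hj.2]

/-- Pigeonhole count: among the bands `0, …, n` at least `n + 1 − #D` miss the finite set `D`. [folklore] -/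
theorem card_free_bands (L : ℝ) (hL : 0 < L) (D : Finset ℝ) (n : ℕ) :
    n + 1 ≤ ((range (n + 1)).filter (fun j ↦ ∀ d ∈ D, d ∉ Set.Ico (L / 16 ^ (j + 1)) (L / 16 ^ j))).card + D.card := by
  classical
  induction D using Finset.induction_on with
  | empty => simp
  | insert a D ha ih =>
    rw [Finset.card_insert_of_notMem ha]
    have hsub : (range (n + 1)).filter (fun j ↦ ∀ d ∈ D, d ∉ Set.Ico (L / 16 ^ (j + 1)) (L / 16 ^ j)) ⊆
        (range (n + 1)).filter (fun j ↦ ∀ d ∈ insert a D, d ∉ Set.Ico (L / 16 ^ (j + 1)) (L / 16 ^ j)) ∪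
          (range (n + 1)).filter (fun j ↦ a ∈ Set.Ico (L / 16 ^ (j + 1)) (L / 16 ^ j)) := by
      intro j hj
      simp only [mem_filter, mem_union] at hj ⊢
      by_cases haj : a ∈ Set.Ico (L / 16 ^ (j + 1)) (L / 16 ^ j)
      · exact Or.inr ⟨hj.1, haj⟩
      · refine Or.inl ⟨hj.1, fun d hd ↦ ?_⟩
        rcases Finset.mem_insert.mp hd with rfl | hd
        · exact haj
        · exact hj.2 d hd
    have hone : ((range (n + 1)).filter (fun j ↦ a ∈ Set.Ico (L / 16 ^ (j + 1)) (L / 16 ^ j))).card ≤ 1 := by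
      refine Finset.card_le_one.mpr fun j hj j' hj' ↦ ?_
      simp only [mem_filter] at hj hj'
      exact band_eq_of_mem hL hj.2 hj'.2
    have := (Finset.card_le_card hsub).trans (Finset.card_union_le _ _)
    omega

/-- **Gap scale below a ceiling.** For a finite set `D` of reals and `L > 0` there is `σ ∈ [L/16^(#D+1), L/16]`
such that every `d ∈ D` is `< σ` or `≥ 16σ`. [folklore] -/
theorem exists_gapScale (D : Finset ℝ) {L : ℝ} (hL : 0 < L) :
    ∃ σ : ℝ, L / 16 ^ (D.card + 1) ≤ σ ∧ σ ≤ L / 16 ∧ ∀ d ∈ D, d < σ ∨ 16 * σ ≤ d := by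
  classical
  have h := card_free_bands L hL D D.card
  have hne : ((range (D.card + 1)).filter (fun j ↦ ∀ d ∈ D, d ∉ Set.Ico (L / 16 ^ (j + 1)) (L / 16 ^ j))).Nonempty := by
    apply Finset.card_pos.mp
    omega
  obtain ⟨j, hj⟩ := hne
  simp only [mem_filter, mem_range] at hj
  refine ⟨L / 16 ^ (j + 1), ?_, ?_, fun d hd ↦ ?_⟩
  · exact div_le_div_of_nonneg_left hL.le (by positivity) (pow_le_pow_right₀ (by norm_num) (by omega))
  · refine div_le_div_of_nonneg_left hL.le (by norm_num) ?_
    calc (16 : ℝ) = 16 ^ 1 := by norm_num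
      _ ≤ 16 ^ (j + 1) := pow_le_pow_right₀ (by norm_num) (by omega)
  · have h1 := hj.2 d hd
    simp only [Set.mem_Ico, not_and, not_lt] at h1
    by_cases h2 : d < L / 16 ^ (j + 1)
    · exact Or.inl h2
    · right
      have h3 := h1 (not_lt.mp h2)
      have h4 : 16 * (L / 16 ^ (j + 1)) = L / 16 ^ j := by
        rw [pow_succ]
        field_simp
      linarith

/-! ### Single-linkage classes at a gap scale -/

variable {N : ℕ}

/-- **A GAP SCALE exists below every ceiling.** For the configuration `ξ · s` and a member set `S`, below every
`L > 0` there is `σ ∈ [L/16^(N²+1), L/16]`, `σ > 0`, such that no pairwise distance inside `S` lies in `[σ, 16σ)`.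
[folklore] -/
theorem exists_gap (ξ : Fin N → ℝ → E3) (s : ℝ) (S : Finset (Fin N)) {L : ℝ} (hL : 0 < L) :
    ∃ σ : ℝ, L / 16 ^ (N ^ 2 + 1) ≤ σ ∧ σ ≤ L / 16 ∧ 0 < σ ∧
      ∀ i ∈ S, ∀ j ∈ S, ‖ξ i s - ξ j s‖ < σ ∨ 16 * σ ≤ ‖ξ i s - ξ j s‖ := by
  classical
  set D : Finset ℝ := (S ×ˢ S).image fun p ↦ ‖ξ p.1 s - ξ p.2 s‖ with hD
  obtain ⟨σ, h1, h2, h3⟩ := exists_gapScale D hL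
  have hcard : D.card ≤ N ^ 2 := by
    calc D.card ≤ (S ×ˢ S).card := Finset.card_image_le
      _ = S.card * S.card := Finset.card_product _ _
      _ ≤ N * N := Nat.mul_le_mul (by simpa using S.card_le_univ) (by simpa using S.card_le_univ)
      _ = N ^ 2 := (sq N).symm
  have hσpos : 0 < σ := lt_of_lt_of_le (by positivity) h1
  refine ⟨σ, le_trans ?_ h1, h2, hσpos, fun i hi j hj ↦ h3 _ ?_⟩
  · exact div_le_div_of_nonneg_left hL.le (by positivity) (pow_le_pow_right₀ (by norm_num) (by omega))
  · exact Finset.mem_image.mpr ⟨(i, j), Finset.mem_product.mpr ⟨hi, hj⟩, rfl⟩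

section Classes

variable {ξ : Fin N → ℝ → E3} {s : ℝ} {S : Finset (Fin N)} {σ : ℝ}

/-- Membership in a class. [folklore] -/
theorem mem_cls_iff {i j : Fin N} : j ∈ Finset.filter (fun jj ↦ ‖ξ i s - ξ jj s‖ < σ) S ↔ j ∈ S ∧ ‖ξ i s - ξ j s‖ < σ := by
  simp

/-- A member belongs to its own class. [folklore] -/
theorem mem_cls_self (hσ : 0 < σ) {i : Fin N} (hi : i ∈ S) : i ∈ Finset.filter (fun jj ↦ ‖ξ i s - ξ jj s‖ < σ) S :=
  mem_cls_iff.mpr ⟨hi, by simpa using hσ⟩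

/-- Under the gap property (no pairwise distance inside `S` in `[σ, 16σ)`) two `σ`-close members have the same
class: classes are cliques. [folklore] -/
theorem cls_eq_of_lt (hσ : 0 < σ) (hgap : ∀ i ∈ S, ∀ j ∈ S, ‖ξ i s - ξ j s‖ < σ ∨ 16 * σ ≤ ‖ξ i s - ξ j s‖)
    {i j : Fin N} (hi : i ∈ S) (hj : j ∈ S) (hij : ‖ξ i s - ξ j s‖ < σ) : Finset.filter (fun jj ↦ ‖ξ i s - ξ jj s‖ < σ) S = Finset.filter (fun jj ↦ ‖ξ j s - ξ jj s‖ < σ) S := by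
  have key : ∀ i j k, i ∈ S → j ∈ S → k ∈ S → ‖ξ i s - ξ j s‖ < σ → ‖ξ i s - ξ k s‖ < σ → ‖ξ j s - ξ k s‖ < σ := by
    intro i j k _ hj hk hij hik
    rcases hgap j hj k hk with h | h
    · exact h
    · exfalso
      have : ‖ξ j s - ξ k s‖ ≤ ‖ξ i s - ξ j s‖ + ‖ξ i s - ξ k s‖ := by
        calc ‖ξ j s - ξ k s‖ = ‖(ξ i s - ξ k s) - (ξ i s - ξ j s)‖ := by congr 1; abel
          _ ≤ ‖ξ i s - ξ k s‖ + ‖ξ i s - ξ j s‖ := norm_sub_le _ _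
          _ = _ := add_comm _ _
      linarith
  ext k
  simp only [mem_cls_iff]
  constructor
  · rintro ⟨hk, hik⟩
    exact ⟨hk, key i j k hi hj hk hij hik⟩
  · rintro ⟨hk, hjk⟩
    have hji : ‖ξ j s - ξ i s‖ < σ := by rwa [norm_sub_rev]
    exact ⟨hk, key j i k hj hi hk hji hjk⟩

/-- The representative belongs to the class. [folklore] -/
theorem rep_mem_cls (hσ : 0 < σ) {i : Fin N} (hi : i ∈ S) : (dite (Finset.Nonempty (Finset.filter (fun jj ↦ ‖ξ i s - ξ jj s‖ < σ) S)) (fun hh ↦ Finset.min' (Finset.filter (fun jj ↦ ‖ξ i s - ξ jj s‖ < σ) S) hh) (fun _ ↦ i)) ∈ Finset.filter (fun jj ↦ ‖ξ i s - ξ jj s‖ < σ) S := by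
  have hne : (Finset.filter (fun jj ↦ ‖ξ i s - ξ jj s‖ < σ) S).Nonempty := ⟨i, mem_cls_self hσ hi⟩
  rw [dif_pos hne]
  exact Finset.min'_mem _ _

/-- The representative is a member of `S`. [folklore] -/
theorem rep_mem (hσ : 0 < σ) {i : Fin N} (hi : i ∈ S) : (dite (Finset.Nonempty (Finset.filter (fun jj ↦ ‖ξ i s - ξ jj s‖ < σ) S)) (fun hh ↦ Finset.min' (Finset.filter (fun jj ↦ ‖ξ i s - ξ jj s‖ < σ) S) hh) (fun _ ↦ i)) ∈ S :=
  (mem_cls_iff.mp (rep_mem_cls hσ hi)).1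

/-- A member is `σ`-close to its representative. [folklore] -/
theorem norm_sub_rep_lt (hσ : 0 < σ) {i : Fin N} (hi : i ∈ S) : ‖ξ i s - ξ ((dite (Finset.Nonempty (Finset.filter (fun jj ↦ ‖ξ i s - ξ jj s‖ < σ) S)) (fun hh ↦ Finset.min' (Finset.filter (fun jj ↦ ‖ξ i s - ξ jj s‖ < σ) S) hh) (fun _ ↦ i))) s‖ < σ :=
  (mem_cls_iff.mp (rep_mem_cls hσ hi)).2

/-- **Classes are an equivalence**: under the gap property two members have the same representative iff they
are `σ`-close. [folklore] -/
theorem rep_eq_iff (hσ : 0 < σ) (hgap : ∀ i ∈ S, ∀ j ∈ S, ‖ξ i s - ξ j s‖ < σ ∨ 16 * σ ≤ ‖ξ i s - ξ j s‖)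
    {i j : Fin N} (hi : i ∈ S) (hj : j ∈ S) : (dite (Finset.Nonempty (Finset.filter (fun jj ↦ ‖ξ i s - ξ jj s‖ < σ) S)) (fun hh ↦ Finset.min' (Finset.filter (fun jj ↦ ‖ξ i s - ξ jj s‖ < σ) S) hh) (fun _ ↦ i)) = (dite (Finset.Nonempty (Finset.filter (fun jj ↦ ‖ξ j s - ξ jj s‖ < σ) S)) (fun hh ↦ Finset.min' (Finset.filter (fun jj ↦ ‖ξ j s - ξ jj s‖ < σ) S) hh) (fun _ ↦ j)) ↔ ‖ξ i s - ξ j s‖ < σ := by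
  constructor
  · intro h
    rcases hgap i hi j hj with h' | h'
    · exact h'
    · exfalso
      have h1 := norm_sub_rep_lt (ξ := ξ) (s := s) hσ hi
      have h2 := norm_sub_rep_lt (ξ := ξ) (s := s) hσ hj
      rw [h] at h1
      have : ‖ξ i s - ξ j s‖ ≤ ‖ξ i s - ξ ((dite (Finset.Nonempty (Finset.filter (fun jj ↦ ‖ξ j s - ξ jj s‖ < σ) S)) (fun hh ↦ Finset.min' (Finset.filter (fun jj ↦ ‖ξ j s - ξ jj s‖ < σ) S) hh) (fun _ ↦ j))) s‖ + ‖ξ j s - ξ ((dite (Finset.Nonempty (Finset.filter (fun jj ↦ ‖ξ j s - ξ jj s‖ < σ) S)) (fun hh ↦ Finset.min' (Finset.filter (fun jj ↦ ‖ξ j s - ξ jj s‖ < σ) S) hh) (fun _ ↦ j))) s‖ := by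
        calc ‖ξ i s - ξ j s‖ = ‖(ξ i s - ξ ((dite (Finset.Nonempty (Finset.filter (fun jj ↦ ‖ξ j s - ξ jj s‖ < σ) S)) (fun hh ↦ Finset.min' (Finset.filter (fun jj ↦ ‖ξ j s - ξ jj s‖ < σ) S) hh) (fun _ ↦ j))) s) - (ξ j s - ξ ((dite (Finset.Nonempty (Finset.filter (fun jj ↦ ‖ξ j s - ξ jj s‖ < σ) S)) (fun hh ↦ Finset.min' (Finset.filter (fun jj ↦ ‖ξ j s - ξ jj s‖ < σ) S) hh) (fun _ ↦ j))) s)‖ := by congr 1; abel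
          _ ≤ _ := norm_sub_le _ _
      linarith
  · intro h
    have hc := cls_eq_of_lt hσ hgap hi hj h
    have hne : (Finset.filter (fun jj ↦ ‖ξ i s - ξ jj s‖ < σ) S).Nonempty := ⟨i, mem_cls_self hσ hi⟩
    have hne' : (Finset.filter (fun jj ↦ ‖ξ j s - ξ jj s‖ < σ) S).Nonempty := ⟨j, mem_cls_self hσ hj⟩
    rw [dif_pos hne, dif_pos hne']
    congr 1

/-- Representatives are fixed points. [folklore] -/
theorem rep_rep (hσ : 0 < σ) (hgap : ∀ i ∈ S, ∀ j ∈ S, ‖ξ i s - ξ j s‖ < σ ∨ 16 * σ ≤ ‖ξ i s - ξ j s‖) {i : Fin N}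
    (hi : i ∈ S) : (dite (Finset.Nonempty (Finset.filter (fun jj ↦ ‖ξ ((dite (Finset.Nonempty (Finset.filter (fun jj ↦ ‖ξ i s - ξ jj s‖ < σ) S)) (fun hh ↦ Finset.min' (Finset.filter (fun jj ↦ ‖ξ i s - ξ jj s‖ < σ) S) hh) (fun _ ↦ i))) s - ξ jj s‖ < σ) S)) (fun hh ↦ Finset.min' (Finset.filter (fun jj ↦ ‖ξ ((dite (Finset.Nonempty (Finset.filter (fun jj ↦ ‖ξ i s - ξ jj s‖ < σ) S)) (fun hh ↦ Finset.min' (Finset.filter (fun jj ↦ ‖ξ i s - ξ jj s‖ < σ) S) hh) (fun _ ↦ i))) s - ξ jj s‖ < σ) S) hh) (fun _ ↦ ((dite (Finset.Nonempty (Finset.filter (fun jj ↦ ‖ξ i s - ξ jj s‖ < σ) S)) (fun hh ↦ Finset.min' (Finset.filter (fun jj ↦ ‖ξ i s - ξ jj s‖ < σ) S) hh) (fun _ ↦ i))))) = (dite (Finset.Nonempty (Finset.filter (fun jj ↦ ‖ξ i s - ξ jj s‖ < σ) S)) (fun hh ↦ Finset.min' (Finset.filter (fun jj ↦ ‖ξ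 i s - ξ jj s‖ < σ) S) hh) (fun _ ↦ i)) := by
  rw [rep_eq_iff hσ hgap (rep_mem hσ hi) hi, norm_sub_rev]
  exact norm_sub_rep_lt hσ hi

/-- Characterisation of the representatives. [folklore] -/
theorem mem_reps_iff (hσ : 0 < σ) (hgap : ∀ i ∈ S, ∀ j ∈ S, ‖ξ i s - ξ j s‖ < σ ∨ 16 * σ ≤ ‖ξ i s - ξ j s‖)
    {p : Fin N} : p ∈ (Finset.image (fun ii ↦ (dite (Finset.Nonempty (Finset.filter (fun jj ↦ ‖ξ ii s - ξ jj s‖ < σ) S)) (fun hh ↦ Finset.min' (Finset.filter (fun jj ↦ ‖ξ ii s - ξ jj s‖ < σ) S) hh) (fun _ ↦ ii))) S) ↔ p ∈ S ∧ (dite (Finset.Nonempty (Finset.filter (fun jj ↦ ‖ξ p s - ξ jj s‖ < σ) S)) (fun hh ↦ Finset.min' (Finset.filter (fun jj ↦ ‖ξ p s - ξ jj s‖ < σ) S) hh) (fun _ ↦ p)) = p := by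
  constructor
  · intro hp
    obtain ⟨i, hi, rfl⟩ := Finset.mem_image.mp hp
    exact ⟨rep_mem hσ hi, rep_rep hσ hgap hi⟩
  · rintro ⟨hp, h⟩
    exact Finset.mem_image.mpr ⟨p, hp, h⟩

/-- Representatives are members. [folklore] -/
theorem reps_subset (hσ : 0 < σ) : (Finset.image (fun ii ↦ (dite (Finset.Nonempty (Finset.filter (fun jj ↦ ‖ξ ii s - ξ jj s‖ < σ) S)) (fun hh ↦ Finset.min' (Finset.filter (fun jj ↦ ‖ξ ii s - ξ jj s‖ < σ) S) hh) (fun _ ↦ ii))) S) ⊆ S := by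
  intro p hp
  obtain ⟨i, hi, rfl⟩ := Finset.mem_image.mp hp
  exact rep_mem hσ hi

/-- There are at most `N` classes. [folklore] -/
theorem card_reps_le : ((Finset.image (fun ii ↦ (dite (Finset.Nonempty (Finset.filter (fun jj ↦ ‖ξ ii s - ξ jj s‖ < σ) S)) (fun hh ↦ Finset.min' (Finset.filter (fun jj ↦ ‖ξ ii s - ξ jj s‖ < σ) S) hh) (fun _ ↦ ii))) S)).card ≤ N :=
  Finset.card_image_le.trans (by simpa using S.card_le_univ)

/-- The representative of a member is a representative. [folklore] -/
theorem rep_mem_reps {i : Fin N} (hi : i ∈ S) : (dite (Finset.Nonempty (Finset.filter (fun jj ↦ ‖ξ i s - ξ jj s‖ < σ) S)) (fun hh ↦ Finset.min' (Finset.filter (fun jj ↦ ‖ξ i s - ξ jj s‖ < σ) S) hh) (fun _ ↦ i)) ∈ (Finset.image (fun ii ↦ (dite (Finset.Nonempty (Finset.filter (fun jj ↦ ‖ξ ii s - ξ jj s‖ < σ) S)) (fun hh ↦ Finset.min' (Finset.filter (fun jj ↦ ‖ξ ii s - ξ jj s‖ < σ) S) hh) (fun _ ↦ ii))) S) :=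
  Finset.mem_image_of_mem _ hi

/-- A member is `σ`-close to the representative of its class … [folklore] -/
theorem norm_sub_lt_of_rep_eq (hσ : 0 < σ) (hgap : ∀ i ∈ S, ∀ j ∈ S, ‖ξ i s - ξ j s‖ < σ ∨ 16 * σ ≤ ‖ξ i s - ξ j s‖)
    {i p : Fin N} (hi : i ∈ S) (hp : p ∈ (Finset.image (fun ii ↦ (dite (Finset.Nonempty (Finset.filter (fun jj ↦ ‖ξ ii s - ξ jj s‖ < σ) S)) (fun hh ↦ Finset.min' (Finset.filter (fun jj ↦ ‖ξ ii s - ξ jj s‖ < σ) S) hh) (fun _ ↦ ii))) S)) (h : (dite (Finset.Nonempty (Finset.filter (fun jj ↦ ‖ξ i s - ξ jj s‖ < σ) S)) (fun hh ↦ Finset.min' (Finset.filter (fun jj ↦ ‖ξ i s - ξ jj s‖ < σ) S) hh) (fun _ ↦ i)) = p) : ‖ξ i s - ξ p s‖ < σ := by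
  have hp' := (mem_reps_iff hσ hgap).mp hp
  rw [← rep_eq_iff hσ hgap hi hp'.1, h, hp'.2]

/-- … and `≥ 16σ` away from every other representative. [folklore] -/
theorem le_norm_sub_of_rep_ne (hσ : 0 < σ) (hgap : ∀ i ∈ S, ∀ j ∈ S, ‖ξ i s - ξ j s‖ < σ ∨ 16 * σ ≤ ‖ξ i s - ξ j s‖)
    {i p : Fin N} (hi : i ∈ S) (hp : p ∈ (Finset.image (fun ii ↦ (dite (Finset.Nonempty (Finset.filter (fun jj ↦ ‖ξ ii s - ξ jj s‖ < σ) S)) (fun hh ↦ Finset.min' (Finset.filter (fun jj ↦ ‖ξ ii s - ξ jj s‖ < σ) S) hh) (fun _ ↦ ii))) S)) (h : (dite (Finset.Nonempty (Finset.filter (fun jj ↦ ‖ξ i s - ξ jj s‖ < σ) S)) (fun hh ↦ Finset.min' (Finset.filter (fun jj ↦ ‖ξ i s - ξ jj s‖ < σ) S) hh) (fun _ ↦ i)) ≠ p) : 16 * σ ≤ ‖ξ i s - ξ p s‖ := by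
  have hp' := (mem_reps_iff hσ hgap).mp hp
  rcases hgap i hi p hp'.1 with h' | h'
  · exact absurd (((rep_eq_iff hσ hgap hi hp'.1).mpr h').trans hp'.2) h
  · exact h'

/-- Distinct representatives are `≥ 16σ` apart. [folklore] -/
theorem le_norm_sub_of_ne (hσ : 0 < σ) (hgap : ∀ i ∈ S, ∀ j ∈ S, ‖ξ i s - ξ j s‖ < σ ∨ 16 * σ ≤ ‖ξ i s - ξ j s‖)
    {p q : Fin N} (hp : p ∈ (Finset.image (fun ii ↦ (dite (Finset.Nonempty (Finset.filter (fun jj ↦ ‖ξ ii s - ξ jj s‖ < σ) S)) (fun hh ↦ Finset.min' (Finset.filter (fun jj ↦ ‖ξ ii s - ξ jj s‖ < σ) S) hh) (fun _ ↦ ii))) S)) (hq : q ∈ (Finset.image (fun ii ↦ (dite (Finset.Nonempty (Finset.filter (fun jj ↦ ‖ξ ii s - ξ jj s‖ < σ) S)) (fun hh ↦ Finset.min' (Finset.filter (fun jj ↦ ‖ξ ii s - ξ jj s‖ < σ) S) hh) (fun _ ↦ ii))) S)) (h : p ≠ q) : 16 * σ ≤ ‖ξ p s - ξ q s‖ :=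 by
  have hp' := (mem_reps_iff hσ hgap).mp hp
  exact le_norm_sub_of_rep_ne hσ hgap hp'.1 hq (by rwa [hp'.2])

/-- Sums over `S` split along the classes. [folklore] -/
theorem sum_eq_sum_reps {β : Type*} [AddCommMonoid β] (F : Fin N → β) :
    ∑ j ∈ S, F j = ∑ p ∈ (Finset.image (fun ii ↦ (dite (Finset.Nonempty (Finset.filter (fun jj ↦ ‖ξ ii s - ξ jj s‖ < σ) S)) (fun hh ↦ Finset.min' (Finset.filter (fun jj ↦ ‖ξ ii s - ξ jj s‖ < σ) S) hh) (fun _ ↦ ii))) S), ∑ j ∈ S.filter (fun j ↦ (dite (Finset.Nonempty (Finset.filter (fun jj ↦ ‖ξ j s - ξ jj s‖ < σ) S)) (fun hh ↦ Finset.min' (Finset.filter (fun jj ↦ ‖ξ j s - ξ jj s‖ < σ) S) hh) (fun _ ↦ j)) = p), F j :=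
  (Finset.sum_fiberwise_of_maps_to (fun _ hj ↦ rep_mem_reps hj) F).symm

end Classes

/-- Registered one-line form (carrier `exists_gapScale_sce12` of the crux item) of `exists_gapScale`. [folklore] -/
theorem exists_gapScale_sce12 : ∀ (D : Finset ℝ) (L : ℝ), 0 < L → ∃ σ : ℝ, L / 16 ^ (D.card + 1) ≤ σ ∧ σ ≤ L / 16 ∧ ∀ d ∈ D, d < σ ∨ 16 * σ ≤ d :=
  fun D _ hL ↦ exists_gapScale D hL

end Summit.FinalStateConjecture.FinalStateConjecture.Theorems.SublinearIsFree.Staircase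

end
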